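import Summits.MatrixMultiplication.MatrixMultiplication.Theorems.EdgePencilAsymptoticRank
import HarnessLib

/-!
# Leg symmetry of the asymptotic spectrum: `S_d` acts on `X_d(F)` (`φ ↦ φ^σ`, `φ^σ[t] = φ[t ∘ σ]`), per-leg
# relabellings do not change a class, and the asymptotic rank is leg-symmetric

Support kernel for `stmt-MatrixMultiplication-26697` (`TetraExcessZero : ω(K₄) ≤ ω(2,1,2)`, route
`TetrahedronCarving`; cut of record `closes (TetraExcessZero) (TetraPlusTwo) : ω = 2`, UNCHANGED; lineage
`decomp-mm-lens-6`, generation 44). No item is added or changed; no definition is introduced — the leg action of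
`σ ∈ S_d = Equiv.Perm (Fin d)` on a coordinate tensor `t : (Fin d → ι) → K` is spelled out as the tensor
`t ∘ σ := fun i => t (fun j => i (σ j))` (leg `j` of `t ∘ σ` is leg `σ j` of `t`), and a per-leg relabelling by a
family `g : Fin d → (κ ≃ ι)` as `fun i => t (fun j => g j (i j))`.

WHY (generation 43/44 memos, the CALIBRATION `TROP(n,2) ⟹ ω(K₄) ≤ max(ψ, 24/(5+δ))`): the E-coordinates of
`EdgePencilExponentConstancy` see ONE edge (`01`) of `K₄`; transporting the pair-rate `p_φ` to the other five
edges, and the identity `τ_φ = Σ_{six edges} p^{e}_φ`, need (i) that `φ ↦ φ^σ` preserves `X₄(F)` for every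
`σ ∈ S₄` — THIS FILE, for all `d` — and (ii) that `[T(K₄)_n ∘ σ] = [T(K₄)_n]`, which by §23 reduces to exhibiting
`T(K₄)_n ∘ σ` as a PER-LEG RELABELLING of `T(K₄)_n` (the label triples of the four parties are re-ordered by
`σ`-dependent permutations of `Fin 3`; generation 45).

§23 PER-LEG RELABELLING (`restricts_precompFamily`, `mk_precompFamily_equiv`): `t ≥ (i ↦ t (j ↦ f_j (i j)))`
for ANY family of maps `f_j : κ → ι` (the tree's `restricts_precomp` is the constant family), hence
`[i ↦ t (j ↦ g_j (i j))] = [t]` for a family of bijections.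

§24 THE LEG ACTION ON TENSORS (`apply_legPerm`, `restricts_legPerm`, `kron_legPerm`, `dsum_legPerm`,
`unit_legPerm`): `(A·t) ∘ σ = (A ∘ σ⁻¹)·(t ∘ σ)`, so `t ≥ s ⟹ t∘σ ≥ s∘σ`; `(t ⊗ t')∘σ = (t∘σ) ⊗ (t'∘σ)`,
`(t ⊕ t')∘σ = (t∘σ) ⊕ (t'∘σ)`, `⟨r⟩∘σ = ⟨r⟩`.

§25 THE LEG ACTION ON THE SPECTRUM (`exists_spectrum_legPerm`): for every `σ ∈ S_d` and `φ ∈ X_d(F)` there is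
`φ^σ ∈ X_d(F)` with `φ^σ[t] = φ[t ∘ σ]` for every tensor `t` of a cubic format (the class map `[t] ↦ [t∘σ]` is
the `Antisymmetrization` functor applied to the monotone leg action on `DFinTensor`, built inside the proof;
it is a monotone semiring endomorphism of `T_d(F)` by §24, so `φ ∘ (it)` is again a spectral point).
Consequence (`asympRank_legPerm`): `R̃[t ∘ σ] = R̃[t]` (`R̃ = max_φ φ`, attained, `EdgePencilAsymptoticRank`).

References: Strassen 1988, §2 (the spectrum is functorial under monotone semiring homomorphisms)
[Strassen1988]; Zuiddam 2018, Def. 2.8, §2.3 [Zuiddam2018]; Christandl–Vrana–Zuiddam 2023, §1.1–1.2 (restriction,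
`⊗`, `⊕`, `⟨r⟩` are defined leg-wise, hence `S_k`-equivariant) [ChristandlVranaZuiddam2023]. No `sorry`, no new
axiom, no instance, no notation, no definition.
-/

noncomputable section

set_option linter.dupNamespace false

open Finset Literature.Computability.AlgebraicComplexity
open Literature.Computability.AlgebraicComplexity.DTensor

namespace Summit.MatrixMultiplication.MatrixMultiplication.Theorems.EdgePencil

/-! ## §23 Per-leg relabelling does not change the class -/

section PerLeg

variable {K : Type*} [CommSemiring K] {d : ℕ} {ι κ : Type*}

/-- **Precomposition with a per-leg FAMILY of maps is a restriction**: `t ≥ (i ↦ t (j ↦ f_j (i j)))` (act by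
the transposed `0/1` matrices `[b = f_j a]` on leg `j`). [cite: ChristandlVranaZuiddam2023, §1.1] -/
theorem restricts_precompFamily [Fintype ι] [DecidableEq ι] (f : Fin d → κ → ι) (t : (Fin d → ι) → K) :
    Restricts t (fun i : Fin d → κ => t (fun j => f j (i j))) := by
  refine ⟨fun j (a : κ) (b : ι) => if b = f j a then (1 : K) else 0, ?_⟩
  funext i
  rw [apply_apply_eq]
  simp_rw [prod_ite_eq_eq _ (fun j => f j (i j))]
  rw [Finset.sum_ite_eq' Finset.univ]
  simp

/-- **A per-leg relabelling by bijections does not change the class**: `[i ↦ t (j ↦ g_j (i j))] = [t]`.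
[cite: ChristandlVranaZuiddam2023, §1.2] -/
theorem mk_precompFamily_equiv [Fintype ι] [DecidableEq ι] [Fintype κ] [DecidableEq κ]
    (g : Fin d → κ ≃ ι) (t : (Fin d → ι) → K) :
    DTensorClass.mk (fun i : Fin d → κ => t (fun j => g j (i j))) = DTensorClass.mk t := by
  refine DTensorClass.mk_eq_mk (restricts_precompFamily (fun j => (g j : κ → ι)) t) ?_
  have h := restricts_precompFamily (fun j => ((g j).symm : ι → κ))
    (fun i : Fin d → κ => t (fun j => g j (i j)))
  simpa using h

end PerLeg

/-! ## §24 The leg action of `S_d` on coordinate tensors -/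

section LegAction

variable {K : Type*} [CommSemiring K] {d : ℕ} {ι ι' : Type*}

/-- **`(A·t) ∘ σ = (A ∘ σ⁻¹)·(t ∘ σ)`**: the leg action commutes with the action of leg-wise matrices.
[cite: ChristandlVranaZuiddam2023, §1.1] -/
theorem apply_legPerm [Fintype ι] (σ : Equiv.Perm (Fin d)) (A : Fin d → ι' → ι → K)
    (t : (Fin d → ι) → K) :
    (fun i : Fin d → ι' => apply A t (fun j => i (σ j))) =
      apply (fun j => A (σ.symm j)) (fun k : Fin d → ι => t (fun j => k (σ j))) := by
  funext i
  rw [apply_apply_eq, apply_apply_eq]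
  refine Fintype.sum_equiv (Equiv.arrowCongr σ (Equiv.refl ι)) _ _ fun k => ?_
  have hk : (fun j => (Equiv.arrowCongr σ (Equiv.refl ι) k) (σ j)) = k := by
    funext j
    simp [Equiv.arrowCongr_apply]
  simp only [hk]
  congr 1
  refine Fintype.prod_equiv σ _ _ fun j => ?_
  simp [Equiv.arrowCongr_apply]

/-- **`t ≥ s ⟹ t∘σ ≥ s∘σ`.** [cite: ChristandlVranaZuiddam2023, §1.2] -/
theorem restricts_legPerm [Fintype ι] (σ : Equiv.Perm (Fin d)) {t : (Fin d → ι) → K}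
    {s : (Fin d → ι') → K} (h : Restricts t s) :
    Restricts (fun k : Fin d → ι => t (fun j => k (σ j))) (fun i : Fin d → ι' => s (fun j => i (σ j))) := by
  obtain ⟨A, rfl⟩ := h
  exact ⟨fun j => A (σ.symm j), apply_legPerm σ A t⟩

omit [CommSemiring K] in
/-- **`(t ⊗ t') ∘ σ = (t∘σ) ⊗ (t'∘σ)`** (definitional). [cite: ChristandlVranaZuiddam2023, §1.1] -/
theorem kron_legPerm [CommSemiring K] (σ : Equiv.Perm (Fin d)) (t : (Fin d → ι) → K)
    (t' : (Fin d → ι') → K) :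
    (fun i : Fin d → ι × ι' => kron t t' (fun j => i (σ j))) =
      kron (fun k : Fin d → ι => t (fun j => k (σ j))) (fun k : Fin d → ι' => t' (fun j => k (σ j))) :=
  rfl

/-- **`(t ⊕ t') ∘ σ = (t∘σ) ⊕ (t'∘σ)`.** [cite: ChristandlVranaZuiddam2023, §1.1] -/
theorem dsum_legPerm [Fintype ι] [Fintype ι'] [DecidableEq ι] [DecidableEq ι'] (σ : Equiv.Perm (Fin d))
    (t : (Fin d → ι) → K) (t' : (Fin d → ι') → K) :
    (fun i : Fin d → ι ⊕ ι' => dsum t t' (fun j => i (σ j))) =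
      dsum (fun k : Fin d → ι => t (fun j => k (σ j))) (fun k : Fin d → ι' => t' (fun j => k (σ j))) := by
  funext i
  have h1 := congrFun (apply_legPerm σ (fun _ => embedMat (K := K) (Sum.inl : ι → ι ⊕ ι')) t) i
  have h2 := congrFun (apply_legPerm σ (fun _ => embedMat (K := K) (Sum.inr : ι' → ι ⊕ ι')) t') i
  simp only at h1 h2
  simp only [dsum_def, Pi.add_apply, h1, h2]

/-- **`⟨r⟩ ∘ σ = ⟨r⟩`**: unit tensors are leg-symmetric. [cite: ChristandlVranaZuiddam2023, §1.1] -/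
theorem unit_legPerm [DecidableEq ι] (σ : Equiv.Perm (Fin d)) :
    (fun i : Fin d → ι => unit K d ι (fun j => i (σ j))) = unit K d ι := by
  funext i
  rw [unit_apply, unit_apply]
  exact if_congr ⟨fun h j j' => by simpa using h (σ.symm j) (σ.symm j'), fun h j j' => h (σ j) (σ j')⟩
    rfl rfl

omit [CommSemiring K] in
/-- `(t ∘ σ) ∘ σ⁻¹ = t`. [cite: ChristandlVranaZuiddam2023, §1.1] -/
theorem legPerm_symm_legPerm (σ : Equiv.Perm (Fin d)) (t : (Fin d → ι) → K) :
    (fun i : Fin d → ι => (fun k : Fin d → ι => t (fun j => k (σ j))) (fun j => i (σ.symm j))) = t := by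
  funext i
  simp

end LegAction

/-! ## §25 The leg action on the asymptotic spectrum and on the asymptotic rank -/

section Spectrum

variable (F : Type) [Field F] {d' : ℕ}

/-- **`S_d` ACTS ON `X_d(F)`**: for `σ ∈ S_d` and `φ ∈ X_d(F)` there is `φ^σ ∈ X_d(F)` with
`φ^σ[t] = φ[t ∘ σ]` for every tensor `t` of a cubic format (`d = d' + 2`). The class map `[t] ↦ [t ∘ σ]` is the
antisymmetrization of the monotone leg action on `DFinTensor`; it preserves `1`, `+`, `·`, `≤` (§24).
[cite: Strassen1988, §2] -/
theorem exists_spectrum_legPerm (σ : Equiv.Perm (Fin (d' + 2))) {φ : DTensorClass F (d' + 2) → ℝ}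
    (hφ : φ ∈ DTensorClass.asymptoticSpectrumDTensors F d') :
    ∃ φ' ∈ DTensorClass.asymptoticSpectrumDTensors F d',
      ∀ (n : ℕ) (t : (Fin (d' + 2) → Fin n) → F),
        φ' (DTensorClass.mk t) =
          φ (DTensorClass.mk (fun i : Fin (d' + 2) → Fin n => t (fun j => i (σ j)))) := by
  classical
  -- the leg action on cubic tensors, as an order homomorphism, and its antisymmetrization
  let f : DFinTensor F (d' + 2) →o DFinTensor F (d' + 2) :=
    { toFun := fun T => ⟨T.n, fun i => T.val (fun j => i (σ j))⟩
      monotone' := fun S T h =>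
        (DFinTensor.le_def _ _).2 (restricts_legPerm σ ((DFinTensor.le_def _ _).1 h)) }
  obtain ⟨Ψ, hΨ⟩ : ∃ Ψ : DTensorClass F (d' + 2) →o DTensorClass F (d' + 2),
      ∀ {ι : Type} [Fintype ι] (t : (Fin (d' + 2) → ι) → F),
        Ψ (DTensorClass.mk t) = DTensorClass.mk (fun i : Fin (d' + 2) → ι => t (fun j => i (σ j))) :=
    ⟨f.antisymmetrization, fun t => OrderHom.antisymmetrization_apply_mk f (DFinTensor.ofFun t)⟩
  have hφ' := DTensorClass.mem_asymptoticSpectrumDTensors_iff.1 hφ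
  refine ⟨fun x => φ (Ψ x), ?_, fun n t => by show φ (Ψ (DTensorClass.mk t)) = _; rw [hΨ]⟩
  refine DTensorClass.mem_asymptoticSpectrumDTensors_iff.2 ⟨?_, ?_, ?_, ?_⟩
  · -- `Ψ 1 = 1`
    show φ (Ψ 1) = 1
    rw [DTensorClass.one_def, hΨ, unit_legPerm σ, ← DTensorClass.one_def, hφ'.map_one]
  · -- additivity, on cubic representatives
    intro a b
    show φ (Ψ (a + b)) = φ (Ψ a) + φ (Ψ b)
    refine DTensorClass.ind (p := fun a => φ (Ψ (a + b)) = φ (Ψ a) + φ (Ψ b)) (fun n s => ?_) a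
    refine DTensorClass.ind
      (p := fun b => φ (Ψ (DTensorClass.mk s + b)) = φ (Ψ (DTensorClass.mk s)) + φ (Ψ b)) (fun m u => ?_) b
    show φ (Ψ (DTensorClass.mk s + DTensorClass.mk u)) = φ (Ψ (DTensorClass.mk s)) + φ (Ψ (DTensorClass.mk u))
    rw [DTensorClass.mk_add_mk, hΨ, hΨ, hΨ, dsum_legPerm σ s u, ← DTensorClass.mk_add_mk, hφ'.map_add]
  · -- multiplicativity
    intro a b
    show φ (Ψ (a * b)) = φ (Ψ a) * φ (Ψ b)
    refine DTensorClass.ind (p := fun a => φ (Ψ (a * b)) = φ (Ψ a) * φ (Ψ b)) (fun n s => ?_) a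
    refine DTensorClass.ind
      (p := fun b => φ (Ψ (DTensorClass.mk s * b)) = φ (Ψ (DTensorClass.mk s)) * φ (Ψ b)) (fun m u => ?_) b
    show φ (Ψ (DTensorClass.mk s * DTensorClass.mk u)) = φ (Ψ (DTensorClass.mk s)) * φ (Ψ (DTensorClass.mk u))
    rw [DTensorClass.mk_mul_mk, hΨ, hΨ, hΨ, kron_legPerm σ s u, ← DTensorClass.mk_mul_mk, hφ'.map_mul]
  · -- monotonicity
    intro a b hab
    exact hφ'.mono (Ψ.mono hab)

/-- **`R̃[t ∘ σ] ≤ R̃[t]`**: a maximiser `φ` of `[t∘σ]` gives `R̃[t∘σ] = φ[t∘σ] = φ^σ[t] ≤ R̃[t]`.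
[cite: Zuiddam2018, Cor. 2.13] -/
theorem asympRank_legPerm_le (σ : Equiv.Perm (Fin (d' + 2))) {n : ℕ} (t : (Fin (d' + 2) → Fin n) → F) :
    asympRankOf (fun x y : DTensorClass F (d' + 2) => x ≤ y)
        (DTensorClass.mk (fun i : Fin (d' + 2) → Fin n => t (fun j => i (σ j)))) ≤
      asympRankOf (fun x y : DTensorClass F (d' + 2) => x ≤ y) (DTensorClass.mk t) := by
  obtain ⟨φ, hφ, hφeq⟩ := DTensorClass.exists_mem_spectrum_apply_eq_asympRankOf
    (DTensorClass.mk (fun i : Fin (d' + 2) → Fin n => t (fun j => i (σ j))))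
  obtain ⟨φ', hφ', hφ'eq⟩ := exists_spectrum_legPerm F σ hφ
  rw [← hφeq, ← hφ'eq n t]
  exact DTensorClass.le_asympRankOf hφ' _

/-- **THE ASYMPTOTIC RANK IS LEG-SYMMETRIC**: `R̃[t ∘ σ] = R̃[t]`. [cite: Zuiddam2018, Cor. 2.13] -/
theorem asympRank_legPerm (σ : Equiv.Perm (Fin (d' + 2))) {n : ℕ} (t : (Fin (d' + 2) → Fin n) → F) :
    asympRankOf (fun x y : DTensorClass F (d' + 2) => x ≤ y)
        (DTensorClass.mk (fun i : Fin (d' + 2) → Fin n => t (fun j => i (σ j)))) =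
      asympRankOf (fun x y : DTensorClass F (d' + 2) => x ≤ y) (DTensorClass.mk t) := by
  refine le_antisymm (asympRank_legPerm_le F σ t) ?_
  have h := asympRank_legPerm_le F σ.symm (fun i : Fin (d' + 2) → Fin n => t (fun j => i (σ j)))
  rwa [legPerm_symm_legPerm σ t] at h

/-- **Spectral values are leg-symmetric IN THE MAXIMUM**: `max_φ φ[t∘σ] = max_φ φ[t]`, i.e. for every
`φ ∈ X_d(F)` there is `φ' ∈ X_d(F)` with `φ[t ∘ σ] = φ'[t]` (namely `φ^σ`). [cite: Strassen1988, §2] -/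
theorem exists_spectrum_apply_legPerm_eq (σ : Equiv.Perm (Fin (d' + 2))) {φ : DTensorClass F (d' + 2) → ℝ}
    (hφ : φ ∈ DTensorClass.asymptoticSpectrumDTensors F d') {n : ℕ} (t : (Fin (d' + 2) → Fin n) → F) :
    ∃ φ' ∈ DTensorClass.asymptoticSpectrumDTensors F d',
      φ (DTensorClass.mk (fun i : Fin (d' + 2) → Fin n => t (fun j => i (σ j)))) = φ' (DTensorClass.mk t) := by
  obtain ⟨φ', hφ', h⟩ := exists_spectrum_legPerm F σ hφ
  exact ⟨φ', hφ', (h n t).symm⟩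

end Spectrum

end Summit.MatrixMultiplication.MatrixMultiplication.Theorems.EdgePencil

end
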